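import Summits.QuantumFields.YangMills.Theorems.F4SubCurvatureDoorSubCurvatureKernelKernelSymmetries
import Summits.QuantumFields.YangMills.Theorems.F4SubCurvatureDoorSubCurvatureKernelFaithfulness
import HarnessLib

/-!
# Route `F4SubCurvatureDoor`, crux `SubCurvatureKernel` ⟨stmt-QuantumFields-23036⟩ — SOFT-HALF ASSEMBLY modulo continuity:
# from a CONTINUOUS representing kernel to clauses 1–3, 6, 7 of the crux (pointwise)

Helper file (`--supports stmt-QuantumFields-23036 --as helper`; free-hands seat `ym-line-frs-p2` g17, soft-half scope).  Definition-free, 0 sorry, standard axioms.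
No item is closed; no summit, no crux and no mass gap is proved by this file.

WHAT.  The tenure split of ⟨23036⟩ (owner ym-idea-3 g23, HOME g23/Sketch23036Split.lean) isolates the SOFT KERNEL: `∃ K : ℝ⁴ → ℝ`, continuous off `0`,
bounded off the unit ball, W(B₄)-invariant, pointwise reflection positive, representing `S₁ 2` on `⁰𝒮₂` (clause 6), faithful on King germs (clause 7).
This seat's files deliver clause 6 with a measurable real kernel (✓`real_repr_of_offDiagLimitAlong`), W(B₄)-invariance a.e., and clause 7 for continuous
kernels (✓`faithful_of_kernel`).  The one analytic input left is (C): a CONTINUOUS (off `0`) representing kernel.  This file is the glue that turns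
(C) into the pointwise clauses:

* `bounded_of_version` — a kernel continuous off `0` with the `(1 + ‖u‖⁻¹)⁸` bound off `0` is bounded off the unit ball (clause 2);
* `signedPerm_invariant_of_continuous` — for a leg-scheme limit point, a continuous-off-`0` measurable representing kernel is W(B₄)-invariant
  EVERYWHERE (a.e. by ✓`ae_comp_eq_of_invariant` + ✓px19, then `Measure.eqOn_open_of_ae_eq` on `{u ≠ 0}`, trivial at `0`);
* ★ `soft_clauses_of_continuous_kernel` — for every off-diagonal limit point of the legs (under `MomentBounds6`) and every measurable real kernel
  `K`, CONTINUOUS OFF `0`, with `|K u| ≤ A (1 + ‖u‖⁻¹)⁸` off `0` and the representation of clause 6: clauses 1, 2, 3, 6, 7 of `SubCurvatureKernel`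
  hold for `K` verbatim.  (Clause 4, pointwise RP of the kernel, follows from ✓p733252 `RPPos` by an approximate-identity argument at the
  continuity points `θxᵢ − xⱼ ≠ 0` — NOT in this file; clause 5, sub-curvature, is the crux.)

HONEST LABEL: glue toward the SOFT half of an OPEN-PROBLEM crux; (C) continuity and pointwise RP of the kernel remain OPEN inputs; the SUB-CURVATURE clause
(asymptotic freedom) is untouched; ⟨23036⟩ open; the Yang–Mills mass gap is NOT proved; no summit is proved by a line.
-/

set_option autoImplicit false

noncomputable section

open scoped SchwartzMap BigOperators
open MeasureTheory Filter Topology Set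
open Literature.MathematicalPhysics.QuantumFieldTheory Literature.MathematicalPhysics.QuantumLattice
open Literature.MathematicalPhysics.AQFT
open Summit.QuantumFields.YangMills.Cruxes.OSLegsFromFemtoAndGap.DlrCollarTransfer (MomentBounds6)
open Summit.QuantumFields.YangMills.Cruxes.OSLegsAtWeakCouplingC.Sketch (Separated IsSignedPerm)
open Summit.QuantumFields.YangMills.Cruxes.OSLegsAtWeakCouplingC.Y2Bridge (King.KingClass)
open Summit.QuantumFields.YangMills.Theorems.ROT (IsLegScheme OffDiagLimitAlong)
open Summit.QuantumFields.YangMills.Theorems.NPointIsotropy.Negative (E4)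
open Summit.QuantumFields.YangMills.Theorems.F4SubCurvatureDoorSubCurvatureKernelSymmetries (ae_comp_eq_of_invariant)
open Summit.QuantumFields.YangMills.Theorems.F4SubCurvatureDoorSubCurvatureKernelFaithful (faithful_of_kernel)
open Summit.QuantumFields.YangMills.Theorems.CheckerboardTrialityHyperoctahedral (signedPerm_invariant_of_offDiagLimitAlong)

namespace Summit.QuantumFields.YangMills.Theorems.F4SubCurvatureDoorSubCurvatureKernelSoft

/-- **Clause 2 from the polynomial bound**: a kernel with `|K u| ≤ A (1 + ‖u‖⁻¹)⁸` off `0` is bounded by `2⁸ |A|` off the unit ball. -/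
theorem bounded_of_polyBound (K : E4 → ℝ) {A : ℝ} (hKb : ∀ u, u ≠ 0 → |K u| ≤ A * (1 + ‖u‖⁻¹) ^ 8) :
    ∃ C : ℝ, ∀ x : E4, 1 ≤ ‖x‖ → |K x| ≤ C := by
  refine ⟨|A| * 2 ^ 8, fun x hx => ?_⟩
  have hx0 : x ≠ 0 := by
    intro h; rw [h, norm_zero] at hx; exact absurd hx (by norm_num)
  have h1 : ‖x‖⁻¹ ≤ 1 := inv_le_one_of_one_le₀ hx
  have h2 : (1 + ‖x‖⁻¹) ^ 8 ≤ 2 ^ 8 := pow_le_pow_left₀ (by positivity) (by linarith) 8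
  calc |K x| ≤ A * (1 + ‖x‖⁻¹) ^ 8 := hKb x hx0
    _ ≤ |A| * (1 + ‖x‖⁻¹) ^ 8 := mul_le_mul_of_nonneg_right (le_abs_self A) (by positivity)
    _ ≤ |A| * 2 ^ 8 := mul_le_mul_of_nonneg_left h2 (abs_nonneg A)

/-- A function continuous on the open set `{u ≠ 0}` which agrees a.e. with its composition with a linear isometry agrees with it everywhere. -/
theorem comp_eq_of_ae {K : E4 → ℝ} (hKc : ContinuousOn K {u | u ≠ 0}) (R : E4 ≃ₗᵢ[ℝ] E4)
    (hae : ∀ᵐ u : E4, K (R u) = K u) : ∀ u, K (R u) = K u := by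
  have hUo : IsOpen {u : E4 | u ≠ 0} := isOpen_ne
  have hRne : ∀ u : E4, u ≠ 0 → R u ≠ 0 := fun u hu h0 => hu (by
    have h := R.norm_map u
    rw [h0, norm_zero] at h
    exact norm_eq_zero.1 h.symm)
  have hKRc : ContinuousOn (fun u => K (R u)) {u : E4 | u ≠ 0} :=
    hKc.comp R.continuous.continuousOn fun u hu => hRne u hu
  have hEq : EqOn (fun u => K (R u)) K {u : E4 | u ≠ 0} :=
    Measure.eqOn_open_of_ae_eq (μ := (volume : Measure E4)) (ae_restrict_of_ae hae) hUo hKRc hKc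
  intro u
  by_cases hu : u = 0
  · rw [hu, map_zero]
  · exact hEq hu

variable {G : Type} [Group G] [TopologicalSpace G] [IsTopologicalGroup G] [CompactSpace G]
  [MeasurableSpace G] [BorelSpace G]

/-- ★ **SOFT-HALF ASSEMBLY MODULO CONTINUITY.**  Let `S₁` be an off-diagonal limit point of an admissible leg scheme under `MomentBounds6`, and let
`K : ℝ⁴ → ℝ` be measurable, CONTINUOUS OFF `0`, with `|K u| ≤ A (1 + ‖u‖⁻¹)⁸` off `0`, representing `S₁ 2` on `⁰𝒮₂` (clause 6).  Then clauses 1, 2, 3, 6, 7 of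
`SubCurvatureKernel` hold for `K`: continuity off `0`, boundedness off the unit ball, W(B₄)-invariance everywhere, the representation, and King faithfulness.
[cite: OS1973, §2] [cite: King1986, §2] -/
theorem soft_clauses_of_continuous_kernel (r : LatticeRep G) {a : ℝ → ℝ} (hapos : ∀ β, 0 < a β)
    (ha0 : Tendsto a atTop (𝓝 0)) (hMB : MomentBounds6 G r a) {sch : SpeciesScheme (YMSpecies G)}
    (hsch : IsLegScheme a sch) {φ : ℕ → ℕ} (hφ : Tendsto φ atTop atTop) {S₁ : SchwingerFamily E4}
    (hS₁ : OffDiagLimitAlong r sch φ S₁) (K : E4 → ℝ) (hKm : Measurable K) (hKc : ContinuousOn K {x : E4 | x ≠ 0})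
    {A : ℝ} (hKb : ∀ u, u ≠ 0 → |K u| ≤ A * (1 + ‖u‖⁻¹) ^ 8)
    (hrep : ∀ F : 𝓢((Fin 2 → E4), ℂ), IsOffDiagonal F →
      Integrable (fun x : Fin 2 → E4 => (K (x 0 - x 1) : ℂ) * F x) ∧ S₁ 2 F = ∫ x : Fin 2 → E4, (K (x 0 - x 1) : ℂ) * F x) :
    ContinuousOn K {x : E4 | x ≠ 0} ∧ (∃ C : ℝ, ∀ x : E4, 1 ≤ ‖x‖ → |K x| ≤ C) ∧
      (∀ R : E4 ≃ₗᵢ[ℝ] E4, IsSignedPerm R → ∀ x : E4, K (R x) = K x) ∧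
      (∀ F : 𝓢((Fin 2 → E4), ℂ), IsOffDiagonal F → HasCompactSupport (F : (Fin 2 → E4) → ℂ) →
        Integrable (fun x : Fin 2 → E4 => (K (x 0 - x 1) : ℂ) * F x) ∧ S₁ 2 F = ∫ x : Fin 2 → E4, (K (x 0 - x 1) : ℂ) * F x) ∧
      (∀ ρ : ℝ, 0 < ρ → ∀ R : E4 ≃ₗᵢ[ℝ] E4,
        (∀ F ∈ King.KingClass 2 ρ, S₁ 2 (linActMulti R F) = S₁ 2 F) ↔ (∀ x : E4, x ≠ 0 → ‖x‖ < ρ → K (R x) = K x)) := by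
  -- the complexified kernel and its global bound
  set Kc : E4 → ℂ := fun u => (K u : ℂ) with hKcdef
  have hKcm : Measurable Kc := Complex.measurable_ofReal.comp hKm
  set A' : ℝ := max A ‖Kc 0‖ with hA'
  have hKcb : ∀ u, ‖Kc u‖ ≤ A' * (1 + ‖u‖⁻¹) ^ 8 := by
    intro u
    by_cases hu : u = 0
    · rw [hu]; simp [hA']
    · have h := hKb u hu
      have h1 : (1 : ℝ) ≤ (1 + ‖u‖⁻¹) ^ 8 := one_le_pow₀ (by simp [inv_nonneg.2 (norm_nonneg u)])
      calc ‖Kc u‖ = |K u| := by simp [hKcdef]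
        _ ≤ A * (1 + ‖u‖⁻¹) ^ 8 := h
        _ ≤ A' * (1 + ‖u‖⁻¹) ^ 8 := mul_le_mul_of_nonneg_right (le_max_left _ _) (by positivity)
  -- the representation on separated classes (special case of clause 6)
  have hrepδ : ∀ δ : ℝ, 0 < δ → ∀ F : 𝓢((Fin 2 → E4), ℂ), HasCompactSupport (F : (Fin 2 → E4) → ℂ) →
      tsupport (F : (Fin 2 → E4) → ℂ) ⊆ Separated 2 δ →
        Integrable (fun x : Fin 2 → E4 => Kc (x 0 - x 1) * F x) ∧ S₁ 2 F = ∫ x : Fin 2 → E4, Kc (x 0 - x 1) * F x := by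
    intro δ hδ F _ hFs
    refine hrep F (IsOffDiagonal.of_tsupport_subset fun y hy hco => ?_)
    obtain ⟨i, j, hij, hyij⟩ := (mem_coincidenceLocus y).1 hco
    have h : δ ≤ dist (y i) (y j) := hFs hy i j hij
    rw [hyij, dist_self] at h
    exact absurd h (not_le.2 hδ)
  -- W(B₄)-invariance: a.e. from the S₁-level invariance, then everywhere by continuity
  have hW : ∀ R : E4 ≃ₗᵢ[ℝ] E4, IsSignedPerm R → ∀ x : E4, K (R x) = K x := by
    intro R hR
    have hinv : ∀ F : 𝓢((Fin 2 → E4), ℂ), HasCompactSupport (F : (Fin 2 → E4) → ℂ) →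
        (∃ δ : ℝ, 0 < δ ∧ tsupport (F : (Fin 2 → E4) → ℂ) ⊆ Separated 2 δ) → S₁ 2 (linActMulti R F) = S₁ 2 F := by
      intro F _ ⟨δ, hδ, hFs⟩
      refine signedPerm_invariant_of_offDiagLimitAlong r hapos ha0 hMB hsch hφ hS₁ R hR 2 F
        (IsOffDiagonal.of_tsupport_subset fun y hy hco => ?_)
      obtain ⟨i, j, hij, hyij⟩ := (mem_coincidenceLocus y).1 hco
      have h : δ ≤ dist (y i) (y j) := hFs hy i j hij
      rw [hyij, dist_self] at h
      exact absurd h (not_le.2 hδ)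
    have hae : ∀ᵐ u : E4, Kc (R u) = Kc u := ae_comp_eq_of_invariant (S₁ 2) Kc hKcm hKcb hrepδ R hinv
    have hae' : ∀ᵐ u : E4, K (R u) = K u := hae.mono fun u hu => by
      simpa [hKcdef] using hu
    exact comp_eq_of_ae hKc R hae'
  refine ⟨hKc, bounded_of_polyBound K hKb, hW, fun F hF _ => hrep F hF, ?_⟩
  -- King faithfulness for the continuous kernel
  exact faithful_of_kernel K hKc (S₁ 2) (fun F hF hFc => hrep F hF)

end Summit.QuantumFields.YangMills.Theorems.F4SubCurvatureDoorSubCurvatureKernelSoft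

end
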